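import Literature.AnabelianGeometry.EtaleTheta.ThetaSettingTopology
import Literature.AnabelianGeometry.EtaleTheta.SettingModelChiThetaTopology
import Literature.AnabelianGeometry.EtaleTheta.SettingModelTateThetaTopology
import Literature.AnabelianGeometry.EtaleTheta.SettingModelIndependence
import HarnessLib

/-!
# [EtTh] §1: NON-VACUITY of the root predicate `ThetaSetting.HasThetaTopology` (proof-only)

Mochizuki, *The étale theta function and its Frobenioid-theoretic manifestations*, Publ. RIMS **45** (2009), §1,
pp. 12–13 [cite: MochizukiEtTh2009, §1 p.12]. abc-iut cell, layer L2, seat abc-iut-L2-t1 (§1 ROOT owner).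
PROOF-ONLY (0 `def`): the census predicate `ThetaSetting.HasThetaTopology` (`ThetaSettingTopology.lean`, 13:00Z
v-next item S1-1) is INHABITED at the semi-synthetic models of the R78 cluster — the χ-twisted model
`ThetaSetting.modelχ p` (abc-iut-L2-t1 g4, p433524; topology facts abc-iut-w5-d111 `SettingModelChiThetaTopology`)
and the Tate-sheared stage-2 models `ThetaSetting.modelχq p i j` (abc-iut-L2-t5 g6; `SettingModelTateThetaTopology`)
— and FAILS at the discrete root model `ThetaSetting.model p` (abc-iut-L2-t1 g4, p421399: `hYcl` fails there BY
DESIGN, `SettingModel.not_hYcl_model` p421746), which is why the census keeps it a predicate (rule §0a) rather than a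
field of `ThetaSetting` v4. Consistency evidence only; models are not print's objects.
HONEST FRAMING: [EtTh] is refereed; nothing here bears on [IUTchIII] Cor. 3.12; typed ≠ proved.
-/

noncomputable section

namespace Literature.AnabelianGeometry.EtaleTheta.SettingModel

open Literature.AnabelianGeometry.SemiGraphs

variable (p : ℕ) [Fact p.Prime]

/-- **`HasThetaTopology` HOLDS at the χ-twisted model `modelχ`** (R3 by construction — quotient groups — and
«(Δ^tp_Y)^Θ compact» from `hYcl_modelχ` + temperedness, abc-iut-w5-d111). [cite: MochizukiEtTh2009, §1 p.12] -/
theorem hasThetaTopology_modelχ : (ThetaSetting.modelχ p).HasThetaTopology :=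
  ⟨isQuotientMap_toTheta_modelχ p, isQuotientMap_thetaToEll_modelχ p, isCompact_dtpYTheta_modelχ p⟩

/-- **`HasThetaTopology` HOLDS at every Tate-sheared stage-2 model `modelχq p i j`** (abc-iut-L2-t5 g6 /
abc-iut-w5-d249). [cite: MochizukiEtTh2009, §1 p.12] -/
theorem hasThetaTopology_modelχq (i j : ℤ) (hj : Even j) : (ThetaSetting.modelχq p i j hj).HasThetaTopology :=
  ⟨isQuotientMap_toTheta_modelχq p i j hj, isQuotientMap_thetaToEll_modelχq p i j hj,
    isCompact_dtpYTheta_modelχq p i j hj⟩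

/-- **`HasThetaTopology` FAILS at the discrete root model `model p`**: there `hYcl` fails (`not_hYcl_model`), while
`HasThetaTopology.hYcl` would give it — the constructor site that makes S1-1 a predicate and not a field (census rule
§0a). [cite: MochizukiEtTh2009, §1 p.12] -/
theorem not_hasThetaTopology_model : ¬ (ThetaSetting.model p).HasThetaTopology :=
  fun h => not_hYcl_model p h.hYcl

/-- Hence **`HasThetaTopology` is NOT derivable from the root interface + the guard `IsEtThOrigin`** (the root
model is an `IsEtThOrigin` inhabitant). [cite: MochizukiEtTh2009, §1 p.12] -/
theorem hasThetaTopology_not_derivable :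
    ¬ ∀ D : ThetaSetting p, D.IsEtThOrigin → D.HasThetaTopology :=
  fun h => not_hasThetaTopology_model p (h _ (ThetaSetting.model_isEtThOrigin p))

/-- … and it is JOINTLY SATISFIABLE with the guard: `modelχ` is an `IsEtThOrigin` inhabitant with
`HasThetaTopology`. [cite: MochizukiEtTh2009, §1 p.12] -/
theorem exists_isEtThOrigin_and_hasThetaTopology :
    ∃ D : ThetaSetting p, D.IsEtThOrigin ∧ D.HasThetaTopology :=
  ⟨ThetaSetting.modelχ p, ThetaSetting.modelχ_isEtThOrigin p, hasThetaTopology_modelχ p⟩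

end Literature.AnabelianGeometry.EtaleTheta.SettingModel

end
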